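import Summits.BirchSwinnertonDyer.BirchSwinnertonDyer.Theorems.GoldfeldGoodTwistsLocalTwo
import Literature.NumberTheory.EllipticCurves.HeegnerHypothesisKroneckerProofs
import Literature.NumberTheory.EllipticCurves.PAdicLFunction
import Literature.NumberTheory.EllipticCurves.Rank1Residual.Predicates
import HarnessLib

/-!
# Route `TwoAdicConverse` (rung S3), crux `OrdLambdaHalfAtTwo` (item stmt-BirchSwinnertonDyer-19556), line
# `kato-determinant-greenberg-two`: the twist by a GREENBERG FIELD stays good ORDINARY at `2`
# (clause (ii) of the registered stub `stub_greenbergSupplyAtTwo`, in its exact binder shape)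

Cell `bsd-2adic`, seat `bsd-2adic-conv-1` GEN 24 (`--supports` stmt-BirchSwinnertonDyer-19556; helper; ROUTE-INDEPENDENT
imports — no `Theses` module in the cone).  The skeleton `Cruxes/OrdLambdaHalfAtTwo/Lines/kato_determinant_greenberg_two.lean`
(skeleton `037466d7c4ab`) picks, for a non-CM globally minimal `W/ℚ` good ordinary at `2`, an imaginary quadratic
«Greenberg field» `K` — every prime of `2·N_E` split in `K` (`SatisfiesHeegnerHypothesis (2 * N_E) K`) — and needs
(stub 3 (ii)): every globally minimal model `A` of the twist `W^{(d_K)}` is ordinary at `2` (`IsOrdinaryAt A 2`, the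
hypothesis under which Kato's divisibility and the integral lift of `L₂(g, α)` are applied to `A` in the composition
`OrdLambdaHalfAtTwo_of`).  PROOF (THEOREMS ONLY; nothing new): `2` split in `K` gives `d_K ≡ 1 (mod 8)` (tree theorem
`Literature.SatisfiesHeegnerHypothesis.discr_emod_eight`, the Kronecker-symbol reading of the Heegner hypothesis), hence
`d_K ≡ 1 (mod 4)` and `ℚ(√d_K)/ℚ` is unramified at `2`: by the Goldfeld cell's local analysis
`GoldfeldGoodTwists.hasGoodReductionAtPrime_and_frobeniusTrace_of_smul_eq_quadraticTwist_two` the minimal model `A` has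
good reduction at `2` with `a_2(A) = ±a_2(W)`, so `2 ∤ a_2(A)`: `GoodOrd A 2`, which is `IsOrdinaryAt A 2` by definition.

HONEST FRAMING.  Bookkeeping for one clause of one supply stub; BSD is not proved by any of this.  PARTITION
(D-0054): none — RANK axis S3 × X5@2 stratum (β).

References: B. Gross, *Heegner points on `X₀(N)`* (1984) §3 [Gross1984]; J. Silverman, *AEC* (2009) VII.1,
X.5 [SilvermanAEC2009].
-/

set_option linter.dupNamespace false
set_option autoImplicit false

namespace Summit.BirchSwinnertonDyer.BirchSwinnertonDyer.Theorems.TwoAdicGreenbergTwist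

open WeierstrassCurve Literature.NumberTheory.EllipticCurves Literature.NumberTheory.EllipticCurves.Rank1Residual
  Summit.BirchSwinnertonDyer.BirchSwinnertonDyer.Theorems.GoldfeldGoodTwists

/-- **A Greenberg field has `d_K ≡ 1 (mod 8)`** (its prime `2 ∣ 2N` splits in `K`). [folklore] -/
theorem discr_emod_eight_of_greenbergField {N : ℕ} {K : Type} [Field K] [NumberField K]
    (hK : IsImaginaryQuadratic K) (hH : SatisfiesHeegnerHypothesis (2 * N) K) :
    NumberField.discr K % 8 = 1 :=
  Literature.SatisfiesHeegnerHypothesis.discr_emod_eight hK.1 hH (dvd_mul_right 2 N)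

/-- **Good ORDINARY reduction at `2` is stable under twists by `d ≡ 1 (mod 4)`**: for `W` globally minimal with
`GoodOrd W 2` and a globally minimal `A` with `C • A = W^{(d)}`, `d ≡ 1 (mod 4)`: `GoodOrd A 2` (`A` has good
reduction at `2` and `a_2(A) = ±a_2(W)` is odd). [cite: SilvermanAEC2009, VII.1 Prop. 1.3(b), X.5 Cor. 5.4] -/
theorem goodOrd_two_of_smul_eq_quadraticTwist (W A : WeierstrassCurve ℚ) [W.IsElliptic] [W.IsGloballyMinimal]
    [A.IsGloballyMinimal] (hgo : GoodOrd W 2) {d : ℤ} (hd4 : d % 4 = 1) {C : VariableChange ℚ}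
    (hA : C • A = W.quadraticTwist (d : ℚ)) : GoodOrd A 2 := by
  have hgo₀ : W.HasGoodReductionAtPrime 2 ∧ ¬ (2 : ℤ) ∣ W.frobeniusTrace 2 := hgo
  obtain ⟨hgood', htr⟩ :=
    hasGoodReductionAtPrime_and_frobeniusTrace_of_smul_eq_quadraticTwist_two W A hd4 hA 2 rfl hgo₀.1
  show A.HasGoodReductionAtPrime 2 ∧ ¬ (2 : ℤ) ∣ A.frobeniusTrace 2
  refine ⟨hgood', ?_⟩
  rw [htr]
  intro h
  apply hgo₀.2
  split_ifs at h
  · simpa using h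
  · simpa using h

/-- **Clause (ii) of `stub_greenbergSupplyAtTwo`, in its registered binder shape**: every globally minimal model
`A` of `W^{(d_K)}` (`K` a Greenberg field for `W`, conductor `N_E = W.conductorNorm ℤ`) is ordinary at `2`
(`IsOrdinaryAt A 2`, definitionally `GoodOrd A 2`). [cite: SilvermanAEC2009, VII.1 Prop. 1.3(b), X.5 Cor. 5.4] -/
theorem isOrdinaryAt_two_twist_of_greenbergField (W : WeierstrassCurve ℚ) [W.IsElliptic]
    [W.IsGloballyMinimal] (hgo : GoodOrd W 2) {K : Type} [Field K] [NumberField K]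
    (hK : IsImaginaryQuadratic K ∧ SatisfiesHeegnerHypothesis (2 * W.conductorNorm ℤ) K) :
    ∀ (A : WeierstrassCurve ℚ) [A.IsElliptic] [A.IsGloballyMinimal] (C : VariableChange ℚ),
      C • A = W.quadraticTwist ((NumberField.discr K : ℤ) : ℚ) → IsOrdinaryAt A 2 := by
  intro A _ _ C hA
  have h8 := discr_emod_eight_of_greenbergField hK.1 hK.2
  exact goodOrd_two_of_smul_eq_quadraticTwist W A hgo (by omega) hA

end Summit.BirchSwinnertonDyer.BirchSwinnertonDyer.Theorems.TwoAdicGreenbergTwist
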